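import Mathlib.MeasureTheory.Integral.IntervalIntegral.Basic
import Summits.AtomisticToContinuum.Crystallization.Theorems.OverbindingBudgetAffineLocalisation

/-!
# OverbindingBudget — the near-cluster floor BY ORDERS, with an η-explicit K-side (decomp-a2c lens-4, generation 44)

Draft node of decomp-a2c lens-4 g44 beneath file B of g43 (`…Theorems.OverbindingBudgetAffineLocalisation`: N = `NearClusterFloor`,
Z = `FarAggregatePricing`, cone LI `tbdsg_of_affineLocalisation`; critic rows 651 (5) / 653 / 660 (a)).  Target of record (cone XLVI slot 3):
`TameBalancedDeepScaleGap (122/125) 0 4 (3/50) (1/450)` («TBDSG»).  Memo: `HOME/decomp-a2c-lens-4/g44/memo/NODE-g44-NearFloorOrders.md`.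

## What this file does
1. **Obligation (ii) of N (quantifier repair) and the currency of the margin.**  `BentReferenceStability R` carries `∃ η`, but N's near threshold
   `θ₀` is a fixed literal and the near charts are only `(2θ₀ + Cε₁)`-close to rigid motions; N can consume K only at a NAMED tolerance `η ≥ 2θ₀ + Cε₁`.
   Typed: `BentReferenceStabilityAt η lam μ R` (g42's body at named parameters) and the stretch-free TWO-CURRENCY certificate
   `PureMarginStabilityAt η μ₁ μR R` : `μ₁·G₁ + μR·G_R ≤ H_R` on η-charted windows, `G₁ = gradForm (101/100)` the FIRST-SHELL gradient form (critic
   row 660 (a); structural reason: the radius-`R` Hessian tail compares to `G₁` by first-shell path counting, not to `G_R` at the certifiable `G_R`-margin);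
   PROVED `bentReferenceStability_of_at`, `stretchForm_le_gradForm`, `bentReferenceStabilityAt_of_pureMargin` (every stretch weight `lam ≤ μ₁` is free:
   λ′ = 0 for the near regime), `bentReferenceStability_of_pureMargin` (K_at⁰ ⇒ g42's K_bent); the re-threaded near piece `NearClusterFloorAt η …`
   (WEAKER than N: `nearClusterFloorAt_of_nearClusterFloor`) with cone LII.  Record `R = 4`, `(η, θ₀) = (3/2000, 1/2000)` (memo §1).
2. **Layer 5 beneath N — the Taylor orders about a chosen bent reference.**  For a reference configuration `ẑ` (the datum a proof of N must
   choose) the class pair sum splits EXACTLY as `pairSum Near G y = pairSum Near G ẑ + firstSum + secondSum` (bond-wise Taylor with integral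
   remainder, `pairSum_eq_orders` PROVED from the calculus piece BT).  N ⟸ BT ∧ RD01 ∧ N2:
   * `BondTaylorExpansion` (BT; KNOWN · ATTACKABLE-S): `V(|b+v|) = V(|b|) + V′(|b|)⟪b,v⟫/|b| + ∫₀¹(1−t)·ljBondHess(b+tv)(v) dt` for `|v| < |b|`.
   * `NearReferenceLowOrders η R Rc δm ρ₁ θ θ₀ κ₁` (RD01; NEW · UNDECIDED · IDEA-NEEDED — the crux of N): for every `ν > 0` and all small `ε₁`
     there is an ADMISSIBLE reference `ẑ` (displacement `δm`-Lipschitz relative to reference bonds, `η`-charted along the segment to `y`, clamped to `y`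
     within `Rc·nn` of non-near matter, injective along the segment) whose orders 0 + 1 are floored: `#Near·e⋆ − C·#Gᶜ − κ₁·#Far − ν·Q₁ ≤ ½(pairSum Near G ẑ + firstSum)`,
     `Q₁` = the first-shell displacement-gradient form.  Order 0 is the affine-polytype equation of state (exact-lattice references ≥ e⋆ per site,
     periodisation) plus tail exchange; order 1 is the FIRST-ORDER FLUX BOOKKEEPING on bent near matter (memo §2: every reference architecture
     examined leaves per-site residues ∝ (strain jump)·(rotation gradient)·ℓ² against the certified gain `ν·(rotation gradient)²·ℓ²` — an O(1)
     competition `2c_W` vs `μ̂`, not tunable by ε₁, ρ₁, θ₀; the trivial reference `ẑ = y` is admissible, so RD01 ⟸ N's conclusion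
     (`nearReferenceLowOrders_of_conclusion` PROVED): the piece is the part of N that is NOT certifiable by K).
   * `NearSecondOrderFloor η R Rc δm ρ₁ θ θ₀ κ₂` (N2; TRUE-type · ATTACKABLE-M given K_at⁰): for every pair of margins certified by
     `PureMarginStabilityAt η μ₁ μR R` there is `ν > 0` with `ν·Q₁ − C·#Gᶜ − κ₂·#Far ≤ ½·secondSum` for EVERY admissible `ẑ` (K_at⁰ along the
     segment `ẑ + t(y − ẑ)`, clamping gives the support condition, Hessian tail by first-shell path counting `τ^path(4) = 0.156 < μ₁ ≈ 0.33`,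
     no cubic term; DEAD at `R = 3` where `τ^path = 0.34` ⇒ record `R = 4`).
   LAYER-5 SEAM `nearFloorConclusion_of_orders` / `nearClusterFloorAt_of_orders` PROVED (the order identity + addition; `ν·Q₁` cancels); cones LIII.
Nothing here proves the summit; rung currency 0.  No `sorry`, no new axioms; statements instance-free and `tsum`-free.
-/

namespace Summit.AtomisticToContinuum.Crystallization.Theorems.OverbindingBudgetAffineNearCluster

open Filter Metric Set Topology MeasureTheory
open scoped BigOperators Classical
open Literature.MathematicalPhysics.StatisticalMechanics
open Literature.Geometry.DiscreteGeometry (IsChargeFree bondGraph nearestDist nearestDist_nonneg fccTwoShellPattern hcpTwoShellPattern)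
open Summit.AtomisticToContinuum.Crystallization.Theses.OverbindingBudget (RobustDefectLimitWindows)
open Summit.AtomisticToContinuum.Crystallization.Theses.PricedLinkCensus (ChargedEnergyGap)
open Summit.AtomisticToContinuum.Crystallization.Theorems.OverbindingBudgetGradedBareness (CleanlessExcessT)
open Summit.AtomisticToContinuum.Crystallization.Theorems.OverbindingBudgetCoherentCut (CoherentResidual)
open Summit.AtomisticToContinuum.Crystallization.Theorems.OverbindingBudgetTwoShellShape (TwoShellShape)
open Summit.AtomisticToContinuum.Crystallization.Theorems.OverbindingBudgetMisfitCensusStatements (Bad Short Long)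
open Summit.AtomisticToContinuum.Crystallization.Theorems.OverbindingBudgetMisfitWindowStatements (InWindow offCount)
open Summit.AtomisticToContinuum.Crystallization.Theorems.OverbindingBudgetBalancedCensusStatements
open Summit.AtomisticToContinuum.Crystallization.Theorems.OverbindingBudgetBalancedCensusRecord
open Summit.AtomisticToContinuum.Crystallization.Theorems.OverbindingBudgetHarmonicNormalForm
open Summit.AtomisticToContinuum.Crystallization.Theorems.OverbindingBudgetLocalHarmonicCertificate
open Summit.AtomisticToContinuum.Crystallization.Theorems.OverbindingBudgetAffineLadder
open Summit.AtomisticToContinuum.Crystallization.Theorems.OverbindingBudgetAffineLocalisation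

variable {N : ℕ}

local notation "E3" => EuclideanSpace ℝ (Fin 3)

/-! ## §1  The η-explicit K-side (obligation (ii)) and the free stretch weight -/

/-- **K_at · `BentReferenceStabilityAt η lam μ R`** — the body of g42's `BentReferenceStability R` at NAMED tolerance `η`, stretch weight `lam`
and margin `μ` (margin form `gradForm R`) — the bridge to g42's K_bent (`bentReferenceStability_of_at`).  N consumes the K-side at `η ≥ 2θ₀ + Cε₁`
(the near charts are `(2θ₀ + Cε₁)`-close to rigid motions by `AffineChartStraightening`; the `A` of `BentChart` is a linear isometry) through the
first-shell-currency form K_at⁰ below.  Numerics (memo §1, fcc Bloch, λ′ = 0, a = 1 = binding corner): `μ₁ := inf_k λ_min(Ĥ_R)/ĝ₁ = 0.577 (R = 3) /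
0.572 (R = 4)`, chart-error weight `π₁ = 157` per unit `η`, so the certifiable first-shell margin at `η = 3/2000` is `≈ 0.34`. -/
def BentReferenceStabilityAt (η lam μ R : ℝ) : Prop :=
  ∀ (Z : Set E3) (σ : E3 → ℝ) (T : Finset E3), (↑T : Set E3) ⊆ Z → (∀ x ∈ T, BentChart η R Z σ x) →
    ∀ (w : E3 → E3), (∀ x, w x ≠ 0 → x ∈ T ∧ ∀ z ∈ Z, dist x z ≤ R → z ∈ T) →
      lam * stretchForm σ T w + μ * gradForm R T w ≤ hessForm R T w

/-- **K_at⁰ · `PureMarginStabilityAt η μ₁ μR R`** — the stretch-free certificate in TWO CURRENCIES on `η`-charted radius-`R` windows: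
`μ₁·G₁ + μR·G_R ≤ H_R`, where `G₁ := gradForm (101/100)` is the FIRST-SHELL gradient form (on charted windows `σ ≤ 1`, first-shell bonds `≤ 1.002 < 101/100`,
second shell `≥ 1.34`) and `G_R := gradForm R`.  The first-shell currency is the one the near regime needs (critic row 660 (a), and structurally: the
radius-`R` Hessian TAIL is comparable to `G₁` by first-shell path counting, `τ^path(4) = 0.156`, while the best certifiable `G_R`-margin is pinned by smooth
fields and loses a factor `≈ 12` against rough ones — memo §1.3); `μR > 0` is kept only to feed g42's K_bent.  What I-SOS-η certifies (memo §5):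
`H_R − η·Π_R − μ₁·G₁ − μR·G_R = Σ_x q_x` translation-covariant SOS, then the termwise transplant. -/
def PureMarginStabilityAt (η μ₁ μR R : ℝ) : Prop :=
  ∀ (Z : Set E3) (σ : E3 → ℝ) (T : Finset E3), (↑T : Set E3) ⊆ Z → (∀ x ∈ T, BentChart η R Z σ x) →
    ∀ (w : E3 → E3), (∀ x, w x ≠ 0 → x ∈ T ∧ ∀ z ∈ Z, dist x z ≤ R → z ∈ T) →
      μ₁ * gradForm (101 / 100) T w + μR * gradForm R T w ≤ hessForm R T w

/-- K_at at positive parameters gives g42's K_bent (PROVED, definitional). [this file] -/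
theorem bentReferenceStability_of_at {η lam μ R : ℝ} (hη : 0 < η) (hl : 0 < lam) (hμ : 0 < μ)
    (h : BentReferenceStabilityAt η lam μ R) : BentReferenceStability R :=
  ⟨η, hη, lam, hl, μ, hμ, h⟩

/-- The linearised stretch is at most the full relative displacement: `⟪d̂, v⟫² ≤ ‖v‖²` (Cauchy–Schwarz). [this file] -/
theorem bondStretchSq_le_norm_sq (d v : E3) : bondStretchSq d v ≤ ‖v‖ ^ 2 := by
  unfold bondStretchSq
  have h1 : |inner ℝ d v / ‖d‖| ≤ ‖v‖ := by
    by_cases hd : ‖d‖ = 0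
    · rw [hd, div_zero, abs_zero]; exact norm_nonneg v
    · rw [abs_div, abs_norm, div_le_iff₀ (lt_of_le_of_ne (norm_nonneg d) (Ne.symm hd))]
      calc |inner ℝ d v| ≤ ‖d‖ * ‖v‖ := abs_real_inner_le_norm d v
        _ = ‖v‖ * ‖d‖ := mul_comm _ _
  calc (inner ℝ d v / ‖d‖) ^ 2 = |inner ℝ d v / ‖d‖| ^ 2 := (sq_abs _).symm
    _ ≤ ‖v‖ ^ 2 := pow_le_pow_left₀ (abs_nonneg _) h1 2

/-- **The stretch form is dominated by the gradient form** on windows whose sites have scale `σ x ≤ 1`, once `R ≥ 101/100`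
(first-shell cutoff `101/100·σ x ≤ R`, and `⟪d̂, v⟫² ≤ ‖v‖²` termwise). [this file] -/
theorem stretchForm_le_gradForm {R : ℝ} (hR : 101 / 100 ≤ R) (σ : E3 → ℝ) (T : Finset E3) (hσ : ∀ x ∈ T, σ x ≤ 1)
    (w : E3 → E3) : stretchForm σ T w ≤ gradForm R T w := by
  unfold stretchForm gradForm
  refine Finset.sum_le_sum fun x hx => Finset.sum_le_sum fun z _ => ?_
  by_cases h1 : x ≠ z ∧ dist x z ≤ 101 / 100 * σ x
  · have h2 : x ≠ z ∧ dist x z ≤ R :=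
      ⟨h1.1, h1.2.trans (le_trans (mul_le_of_le_one_right (by norm_num) (hσ x hx)) hR)⟩
    rw [if_pos h1, if_pos h2]
    exact bondStretchSq_le_norm_sq _ _
  · rw [if_neg h1]
    split_ifs
    · positivity
    · exact le_rfl

/-- **The stretch weight is free (PROVED):** the two-currency pure margin certificate gives K_at with every stretch weight `0 ≤ lam ≤ μ₁` and
`G_R`-margin `μR` (`stretchForm ≤ G₁` termwise on charted windows, `σ ≤ 1`).  So the near regime takes `λ′ = 0` in I-SOS. [this file] -/
theorem bentReferenceStabilityAt_of_pureMargin {η μ₁ μR R lam : ℝ} (hlam : 0 ≤ lam) (hle : lam ≤ μ₁)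
    (h : PureMarginStabilityAt η μ₁ μR R) : BentReferenceStabilityAt η lam μR R := by
  intro Z σ T hTZ hch w hw
  have hS : stretchForm σ T w ≤ gradForm (101 / 100) T w :=
    stretchForm_le_gradForm le_rfl σ T (fun x hx => (hch x hx).2.1) w
  have hH := h Z σ T hTZ hch w hw
  nlinarith [hS, hH, hlam, hle, gradForm_nonneg (101 / 100) T w, stretchForm_le_gradForm le_rfl σ T (fun x hx => (hch x hx).2.1) w]

/-- K_at⁰ at positive parameters gives g42's K_bent (PROVED). [this file] -/
theorem bentReferenceStability_of_pureMargin {η μ₁ μR R : ℝ} (hη : 0 < η) (hμ₁ : 0 < μ₁) (hμR : 0 < μR)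
    (h : PureMarginStabilityAt η μ₁ μR R) : BentReferenceStability R :=
  ⟨η, hη, μ₁, hμ₁, μR, hμR, bentReferenceStabilityAt_of_pureMargin hμ₁.le le_rfl h⟩

/-! ## §2  N's conclusion, the re-threaded near piece, and cone LII -/

/-- **The conclusion of N** (its body after the two hypotheses `K_bent R`, `R_aff`; verbatim from file B). -/
def NearFloorConclusion (ρ₁ θ θ₀ κ : ℝ) : Prop :=
  ∃ ε₀ : ℝ, 0 < ε₀ ∧ ∀ ε₁ : ℝ, 0 < ε₁ → ε₁ ≤ ε₀ → ∀ δ : ℝ, 0 < δ → δ ≤ 2 →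
    ∃ C : ℝ, 0 ≤ C ∧ ∀ (N : ℕ) (y : Fin N → E3), Function.Injective y →
      ((nearSet θ₀ ρ₁ ε₁ θ δ y).card : ℝ) * (⨅ Q : PeriodicConfiguration 3, Q.energyPerParticle lennardJones)
        - C * (((goodSet ρ₁ ε₁ θ δ y)ᶜ).card : ℝ) - κ * ((farSet θ₀ ρ₁ ε₁ θ δ y).card : ℝ)
        ≤ 1 / 2 * pairSum (nearSet θ₀ ρ₁ ε₁ θ δ y) (goodSet ρ₁ ε₁ θ δ y) y

/-- The conclusion outright gives N at every `R` (PROVED, definitional). [this file] -/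
theorem nearClusterFloor_of_conclusion {R ρ₁ θ θ₀ κ : ℝ} (h : NearFloorConclusion ρ₁ θ θ₀ κ) :
    NearClusterFloor R ρ₁ θ θ₀ κ :=
  fun _ _ => h

/-- **N_at · `NearClusterFloorAt η R ρ₁ θ θ₀ κ`** — N consuming the η-EXPLICIT, first-shell-currency K-side: given K_at⁰ at tolerance `η` (some
`μ₁, μR > 0`) and R_aff, N's conclusion.  WEAKER than N for `η > 0` (`nearClusterFloorAt_of_nearClusterFloor`); it is the honest form of N (claimed for
`η > 2θ₀`: the near charts must fit inside the certified tolerance; record `(η, θ₀) = (3/2000, 1/2000)`, memo §1). -/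
def NearClusterFloorAt (η R ρ₁ θ θ₀ κ : ℝ) : Prop :=
  (∃ μ₁ μR : ℝ, 0 < μ₁ ∧ 0 < μR ∧ PureMarginStabilityAt η μ₁ μR R) → AffineChartStraightening → NearFloorConclusion ρ₁ θ θ₀ κ

/-- **N ⇒ N_at** at every `η > 0` (PROVED): N_at is on the weaker side of N. [this file] -/
theorem nearClusterFloorAt_of_nearClusterFloor {η R ρ₁ θ θ₀ κ : ℝ} (hη : 0 < η) (hN : NearClusterFloor R ρ₁ θ θ₀ κ) :
    NearClusterFloorAt η R ρ₁ θ θ₀ κ := by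
  rintro ⟨μ₁, μR, h1, h2, hK⟩ hR
  exact hN (bentReferenceStability_of_pureMargin hη h1 h2 hK) hR

/-- **CONE LII (slot 3 with the η-explicit K-side; PROVED):**
`0 < η → (∃ μ₁ μR > 0, K_at⁰ η μ₁ μR R) → R_aff → D → N_at η R ρ₁ θ θ₀ κ → Z ρ₁ θ θ₀ κ → AffMidAll ρ₁ θ → TBDSG`. [this file; file B cone LI] -/
theorem tbdsg_of_affineLocalisationAt (η R ρ₁ θ θ₀ κ : ℝ) (hη : 0 < η)
    (hK : ∃ μ₁ μR : ℝ, 0 < μ₁ ∧ 0 < μR ∧ PureMarginStabilityAt η μ₁ μR R) (hR : AffineChartStraightening)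
    (hD : DefectPairFloor) (hN : NearClusterFloorAt η R ρ₁ θ θ₀ κ) (hZ : FarAggregatePricing ρ₁ θ θ₀ κ) (hM : AffMidAll ρ₁ θ) :
    TameBalancedDeepScaleGap (122 / 125) 0 4 (3 / 50) (1 / 450) := by
  obtain ⟨μ₁, μR, h1, h2, hKat⟩ := hK
  exact tbdsg_of_affineLocalisation R ρ₁ θ θ₀ κ (bentReferenceStability_of_pureMargin hη h1 h2 hKat) hR hD
    (nearClusterFloor_of_conclusion (hN ⟨μ₁, μR, h1, h2, hKat⟩ hR)) hZ hM

/-! ## §3  LAYER 5 — the Taylor orders of the class pair sum about a reference configuration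
Data: a reference configuration `ẑ : Fin N → E3` (chosen by the proof of N); reference bond `b_ij := ẑ j − ẑ i`, displacement `w := y − ẑ`, bond
displacement `v_ij := w j − w i = (y j − y i) − b_ij`; `ẑ = y` off the displacement support, so all class sums range over `Near × G` exactly as in N. -/

/-- **First-order sum** `Σ_{i∈S} Σ_{j∈T} V′(|b_ij|)·⟪b_ij, v_ij⟫/|b_ij|` (ordered pairs; diagonal `0`). -/
noncomputable def firstSum (S T : Finset (Fin N)) (y z : Fin N → E3) : ℝ :=
  ∑ i ∈ S, ∑ j ∈ T, ljD1 ‖z j - z i‖ * (inner ℝ (z j - z i) ((y j - y i) - (z j - z i)) / ‖z j - z i‖)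

/-- **Second-order sum with integral remainder** `Σ_{i∈S} Σ_{j∈T} ∫₀¹ (1−t)·ljBondHess(b_ij + t v_ij)(v_ij) dt` — the second variation
integrated along the segment from `ẑ` to `y` (no cubic remainder: K_at is applied at every point of the segment). -/
noncomputable def secondSum (S T : Finset (Fin N)) (y z : Fin N → E3) : ℝ :=
  ∑ i ∈ S, ∑ j ∈ T, ∫ t in (0 : ℝ)..1,
    (1 - t) * ljBondHess ((z j - z i) + t • ((y j - y i) - (z j - z i))) ((y j - y i) - (z j - z i))

/-- **Radius-`Rg` displacement-gradient form** `Q_Rg := Σ_{i∈S} Σ_{j∈T, j≠i, |b_ij| ≤ Rg} ‖v_ij‖²` — the index version of `gradForm Rg` on the class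
bonds (reference distances).  Used at `Rg = 101/100`: the FIRST-SHELL displacement gradient `Q₁`, the currency `ν·Q₁` transferred from the second-order piece
to the low-order piece (near matter's reference first shell is `≤ 1.002 < 101/100 < 1.34 ≤` second shell). -/
noncomputable def dispGradSum (R : ℝ) (S T : Finset (Fin N)) (y z : Fin N → E3) : ℝ :=
  ∑ i ∈ S, ∑ j ∈ T, if j ≠ i ∧ dist (z i) (z j) ≤ R then ‖(y j - y i) - (z j - z i)‖ ^ 2 else 0

/-- The displacement-gradient form is nonnegative. [this file] -/
theorem dispGradSum_nonneg (R : ℝ) (S T : Finset (Fin N)) (y z : Fin N → E3) : 0 ≤ dispGradSum R S T y z :=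
  Finset.sum_nonneg fun _ _ => Finset.sum_nonneg fun _ _ => by split_ifs <;> positivity

/-- **BT · `BondTaylorExpansion`** (KNOWN · ATTACKABLE-S; one-variable Taylor with integral remainder for `t ↦ V(|b + t v|)`, smooth on
`[0,1]` since `|v| < |b|` keeps the bond away from `0`; `ljD1 = V′`, `ljBondHess d v = d²/dτ² V(|d + τ v|)` at `τ = 0`).  WHY IT MIGHT FAIL:
only by a slip in the normal form's `ljD1/ljD2/ljBondHess` bookkeeping (checked: `V′ = −r⁻¹³ + r⁻⁷`, `V″ = 13r⁻¹⁴ − 7r⁻⁸`). [calculus] -/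
def BondTaylorExpansion : Prop :=
  ∀ b v : E3, ‖v‖ < ‖b‖ →
    lennardJones ‖b + v‖ = lennardJones ‖b‖ + ljD1 ‖b‖ * (inner ℝ b v / ‖b‖)
      + ∫ t in (0 : ℝ)..1, (1 - t) * ljBondHess (b + t • v) v

/-- **THE ORDER IDENTITY (PROVED from BT):** if every off-diagonal class bond is Taylor-admissible (`‖v_ij‖ < ‖b_ij‖`), then
`pairSum S T y = pairSum S T ẑ + firstSum S T y ẑ + secondSum S T y ẑ` (diagonal terms vanish on both sides: `V(0) = 0`,
`⟪0, ·⟫ = 0`, `ljBondHess · 0 = 0`). [this file] -/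
theorem pairSum_eq_orders (hBT : BondTaylorExpansion) {S T : Finset (Fin N)} {y z : Fin N → E3}
    (hT : ∀ i ∈ S, ∀ j ∈ T, j ≠ i → ‖(y j - y i) - (z j - z i)‖ < ‖z j - z i‖) :
    pairSum S T y = pairSum S T z + firstSum S T y z + secondSum S T y z := by
  unfold pairSum firstSum secondSum
  rw [← Finset.sum_add_distrib, ← Finset.sum_add_distrib]
  refine Finset.sum_congr rfl fun i hi => ?_
  rw [← Finset.sum_add_distrib, ← Finset.sum_add_distrib]
  refine Finset.sum_congr rfl fun j hj => ?_
  by_cases hij : j = i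
  · subst hij
    simp [dist_self, lennardJones_zero, ljBondHess, bondStretchSq]
  · have h := hBT (z j - z i) ((y j - y i) - (z j - z i)) (hT i hi j hj hij)
    have e1 : z j - z i + ((y j - y i) - (z j - z i)) = y j - y i := by abel
    rw [e1] at h
    rw [dist_eq_norm, norm_sub_rev, h, dist_eq_norm, norm_sub_rev (z i) (z j)]

/-- **Admissible reference data** for the near class of `y` at `(θ₀, ρ₁, ε₁, θ, δ)`: a reference configuration `ẑ` with
(a) LIPSCHITZ DISPLACEMENT: on the class bonds `Near × G` the relative displacement is `δm`-small RELATIVE TO THE REFERENCE BOND,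
    `‖v_ij‖ ≤ δm·|b_ij|` (all ranges; no bound on `sup ‖w‖` — a gently bent component may drift far from its reference lattice, only gradients
    matter; with `δm < 1` and `y` injective this gives Taylor-admissibility `‖v_ij‖ < |b_ij|`, cutoff stability and tail control along the segment);
(b) CLAMPING: `ẑ` differs from `y` only at near sites all of whose `Rc·nearestDist`-neighbours are near (so the displacement `w = y − ẑ` and its
    radius-`R` neighbourhood avoid far and bad matter — K_at⁰'s support condition at index level; near sites have `nn ≥ 0.956·(122/125)`);
(c) INJECTIVE SEGMENT: every `ẑ + t(y − ẑ)`, `t ∈ [0,1]`, is injective;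
(d) CHARTS ALONG THE SEGMENT: for every `t ∈ [0,1]` some scale field makes every site within `R + 1` of the displacement support an
    `η`-`BentChart` of radius `R` of the configuration `ẑ + t(y − ẑ)` (word and scale per site).
The trivial reference `ẑ = y` is admissible (empty support; `refAdmissible_self`). [this file] -/
def RefAdmissible (η R Rc δm θ₀ ρ₁ ε₁ θ δ : ℝ) (y z : Fin N → E3) : Prop :=
  (∀ i ∈ nearSet θ₀ ρ₁ ε₁ θ δ y, ∀ j ∈ goodSet ρ₁ ε₁ θ δ y, ‖(y j - y i) - (z j - z i)‖ ≤ δm * dist (z i) (z j)) ∧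
  (∀ i, z i ≠ y i → i ∈ nearSet θ₀ ρ₁ ε₁ θ δ y ∧
      ∀ j, dist (y j) (y i) ≤ Rc * nearestDist y i → j ∈ nearSet θ₀ ρ₁ ε₁ θ δ y) ∧
  (∀ t ∈ Set.Icc (0 : ℝ) 1, Function.Injective fun j => z j + t • (y j - z j)) ∧
  (∀ t ∈ Set.Icc (0 : ℝ) 1, ∃ σ : E3 → ℝ, ∀ i, (∃ k, z k ≠ y k ∧ dist (z k) (z i) ≤ R + 1) →
      BentChart η R (Set.range fun j => z j + t • (y j - z j)) σ (z i + t • (y i - z i)))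

/-- The trivial reference `ẑ = y` is admissible for injective `y` and `δm ≥ 0` (PROVED) — so RD01 below is implied by N's conclusion: the piece is
WEAKER than the target by construction, and its content is the freedom to choose `ẑ`. [this file] -/
theorem refAdmissible_self {η R Rc δm θ₀ ρ₁ ε₁ θ δ : ℝ} (hδm : 0 ≤ δm) {y : Fin N → E3} (hy : Function.Injective y) :
    RefAdmissible η R Rc δm θ₀ ρ₁ ε₁ θ δ y y := by
  refine ⟨fun i _ j _ => ?_, fun i h => (h rfl).elim, fun t _ => ?_, fun t _ => ⟨fun _ => 1, ?_⟩⟩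
  · rw [sub_self, norm_zero]; positivity
  · intro i j h
    exact hy (by simpa using h)
  · rintro i ⟨k, hk, -⟩
    exact (hk rfl).elim

/-- Lipschitz displacement with `δm < 1` on an injective configuration is Taylor-admissible (PROVED). [this file] -/
theorem taylor_of_refAdmissible {η R Rc δm θ₀ ρ₁ ε₁ θ δ : ℝ} (hδm : δm < 1) {y z : Fin N → E3} (hy : Function.Injective y)
    (h : RefAdmissible η R Rc δm θ₀ ρ₁ ε₁ θ δ y z) :
    ∀ i ∈ nearSet θ₀ ρ₁ ε₁ θ δ y, ∀ j ∈ goodSet ρ₁ ε₁ θ δ y, j ≠ i → ‖(y j - y i) - (z j - z i)‖ < ‖z j - z i‖ := by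
  intro i hi j hj hij
  have hL := h.1 i hi j hj
  have hd : dist (z i) (z j) = ‖z j - z i‖ := by rw [dist_comm, dist_eq_norm]
  rw [hd] at hL
  have hpos : 0 < ‖z j - z i‖ := by
    rcases (norm_nonneg (z j - z i)).lt_or_eq with hlt | heq
    · exact hlt
    · exfalso
      have hz : z j - z i = 0 := norm_eq_zero.1 heq.symm
      rw [hz, sub_zero, norm_zero, mul_zero] at hL
      have hyz : y j - y i = 0 := norm_eq_zero.1 (le_antisymm hL (norm_nonneg _))
      exact hij (hy (sub_eq_zero.1 hyz))
  calc ‖(y j - y i) - (z j - z i)‖ ≤ δm * ‖z j - z i‖ := hL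
    _ < 1 * ‖z j - z i‖ := mul_lt_mul_of_pos_right hδm hpos
    _ = ‖z j - z i‖ := one_mul _

/-- **RD01 · `NearReferenceLowOrders η R Rc δm ρ₁ θ θ₀ κ₁`** (NEW · UNDECIDED · IDEA-NEEDED — the crux of N; obligation (i) lives here).
Given R_aff: for every transfer rate `ν > 0` there is `ε₀ > 0` such that for all `ε₁ ≤ ε₀`, all windows `[δ, 2]`, some `C ≥ 0`, EVERY injective
configuration admits an ADMISSIBLE reference `ẑ` whose orders 0 + 1 are floored:
`#Near·e⋆ − C·#Gᶜ − κ₁·#Far − ν·Q₁(y, ẑ) ≤ ½·(pairSum Near G ẑ + firstSum Near G y ẑ)`.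
Intended construction (memo §3): `ẑ` = exact affine-Barlow-lattice images blockwise (charts from `AffineChartStraightening` + Barlow PATCH
RIGIDITY «two-shell exact on a ball of radius r ⇒ one stacking on radius r − 2», ρ₁ ≥ R + 7), C⁰-coherent across block faces, clamped to `y`
within `Rc` of far/bad matter; order 0 = affine-polytype equation of state `W(BΛ) ≥ e⋆` (periodisation, definitional) + attractive omitted
bonds + tail exchange; order 1 = stress-flux bookkeeping (reference stress-free in block interiors; block mean strain kills `σ_P : Σ∇w`;
rotational kinks flux-free by mirror symmetry; strain jumps telescope to interfaces by the discrete divergence identity; residues by AM-GM into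
`ν·Q` and the CB surplus).  WHY IT MIGHT FAIL: the strain-JUMP × sagitta flux `≈ 2c_W·K_s·K·ℓ²` per site against the gain `ν·K²ℓ²` is an O(1)
competition (`2c_W ∈ [10, 52]` vs `μ̂ ≈ 0.58–2.3`) with no small parameter; the per-site chart alternative kills order 1 identically
(force-weighted least squares) but then order 2 is not a global second variation.  Claimed for `η > 2θ₀` and `Rc ≥ R + 2`.
[lens-4 g44; E–Ming 2007 (Cauchy–Born, inner relaxation), Ortner–Theil 2013, Braun–Schmidt 2013 (discrete-to-continuum with surface terms);
Conti–Dolzmann–Kirchheim–Müller 2006] -/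
def NearReferenceLowOrders (η R Rc δm ρ₁ θ θ₀ κ₁ : ℝ) : Prop :=
  AffineChartStraightening → ∀ ν : ℝ, 0 < ν →
    ∃ ε₀ : ℝ, 0 < ε₀ ∧ ∀ ε₁ : ℝ, 0 < ε₁ → ε₁ ≤ ε₀ → ∀ δ : ℝ, 0 < δ → δ ≤ 2 →
      ∃ C : ℝ, 0 ≤ C ∧ ∀ (N : ℕ) (y : Fin N → E3), Function.Injective y →
        ∃ z : Fin N → E3, RefAdmissible η R Rc δm θ₀ ρ₁ ε₁ θ δ y z ∧
          ((nearSet θ₀ ρ₁ ε₁ θ δ y).card : ℝ) * (⨅ Q : PeriodicConfiguration 3, Q.energyPerParticle lennardJones)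
            - C * (((goodSet ρ₁ ε₁ θ δ y)ᶜ).card : ℝ) - κ₁ * ((farSet θ₀ ρ₁ ε₁ θ δ y).card : ℝ)
            - ν * dispGradSum (101 / 100) (nearSet θ₀ ρ₁ ε₁ θ δ y) (goodSet ρ₁ ε₁ θ δ y) y z
            ≤ 1 / 2 * (pairSum (nearSet θ₀ ρ₁ ε₁ θ δ y) (goodSet ρ₁ ε₁ θ δ y) z
                  + firstSum (nearSet θ₀ ρ₁ ε₁ θ δ y) (goodSet ρ₁ ε₁ θ δ y) y z)

/-- **N2 · `NearSecondOrderFloor η R Rc δm ρ₁ θ θ₀ κ₂`** (TRUE-type · ATTACKABLE-M given K_at⁰).  For every pair of margins `μ₁, μR > 0` certified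
at tolerance `η` (`PureMarginStabilityAt η μ₁ μR R`) there is a transfer rate `ν > 0` such that for all small `ε₁`, all windows, some `C ≥ 0`, EVERY
admissible reference of EVERY injective configuration has its second order floored: `ν·Q₁(y, ẑ) − C·#Gᶜ − κ₂·#Far ≤ ½·secondSum Near G y ẑ`.
Route: at each `t ∈ [0,1]` the configuration `ẑ + t w` is `η`-charted near the displacement support (admissibility (f)), injective (e), and `w` with
its radius-`R` neighbourhood is supported in near matter (b, near sites have `nn ≥ 0.956·(122/125)`): K_at⁰ gives `hessForm R ≥ μ₁·G₁ + μR·G_R` there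
(point forms = index forms by injectivity; near–non-near bonds have `v = 0` by clamping); the bonds beyond `R` are the Hessian TAIL
`|ljBondHess d v| ≤ h(|d|)‖v‖²`, bounded by first-shell PATH COUNTING inside the charted window: `≤ τ^path(R)·G₁`, `τ^path(4) = 0.156` (lattice count
`(1/6)Σ_{|d|>R} N(d)h(d)m(d)²`; state it with 0.20 for `η`-bent chains); `G₁` is constant in `t` (first shell `≤ 1.002 < 101/100 < 1.34`), so
`ν := (μ₁ − 0.20)/4`.  No cubic term (integral remainder).  WHY IT MIGHT FAIL: only if the certified `μ₁ ≤ τ^path(R)` — at `R = 3` the path tail is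
0.34 ≈ the whole certifiable `μ₁(η = 3/2000) ≈ 0.34`: DEAD at `R = 3`, alive at `R = 4` (`μ₁ ≈ 0.33` vs 0.156; memo §1.3) — or if clause (f)'s chart radius
`R + 1` around the support is too small for the path chains (then raise `Rc`). [lens-4 g44; Hudson–Ortner 2012 (stability of locally bent lattices);
E–Ming 2007; Braun–Schmidt 2013 — orientation only, nothing imported] -/
def NearSecondOrderFloor (η R Rc δm ρ₁ θ θ₀ κ₂ : ℝ) : Prop :=
  ∀ μ₁ μR : ℝ, 0 < μ₁ → 0 < μR → PureMarginStabilityAt η μ₁ μR R →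
    ∃ ν : ℝ, 0 < ν ∧ ∃ ε₀ : ℝ, 0 < ε₀ ∧ ∀ ε₁ : ℝ, 0 < ε₁ → ε₁ ≤ ε₀ → ∀ δ : ℝ, 0 < δ → δ ≤ 2 →
      ∃ C : ℝ, 0 ≤ C ∧ ∀ (N : ℕ) (y : Fin N → E3), Function.Injective y → ∀ z : Fin N → E3,
        RefAdmissible η R Rc δm θ₀ ρ₁ ε₁ θ δ y z →
          ν * dispGradSum (101 / 100) (nearSet θ₀ ρ₁ ε₁ θ δ y) (goodSet ρ₁ ε₁ θ δ y) y z
            - C * (((goodSet ρ₁ ε₁ θ δ y)ᶜ).card : ℝ) - κ₂ * ((farSet θ₀ ρ₁ ε₁ θ δ y).card : ℝ)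
            ≤ 1 / 2 * secondSum (nearSet θ₀ ρ₁ ε₁ θ δ y) (goodSet ρ₁ ε₁ θ δ y) y z

/-- **LAYER-5 SEAM (PROVED): `BT → RD01 → N2 → (K_at⁰ η at some μ₁, μR > 0) → R_aff → δm < 1 → κ₁ + κ₂ ≤ κ → NearFloorConclusion ρ₁ θ θ₀ κ`.**
N2 fixes the transfer rate `ν` from K_at⁰'s margins; RD01 is invoked at that `ν`; `ε₀ := min`, `C := C₁ + C₂`; for each configuration RD01's
reference `ẑ` is fed to N2 and to the order identity `pairSum_eq_orders`; the `ν·Q` transfer cancels in the sum. [this file] -/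
theorem nearFloorConclusion_of_orders {η R Rc δm ρ₁ θ θ₀ κ₁ κ₂ κ : ℝ} (hBT : BondTaylorExpansion)
    (h01 : NearReferenceLowOrders η R Rc δm ρ₁ θ θ₀ κ₁) (h2 : NearSecondOrderFloor η R Rc δm ρ₁ θ θ₀ κ₂)
    (hK : ∃ μ₁ μR : ℝ, 0 < μ₁ ∧ 0 < μR ∧ PureMarginStabilityAt η μ₁ μR R) (hR : AffineChartStraightening)
    (hδm : δm < 1) (hκ : κ₁ + κ₂ ≤ κ) : NearFloorConclusion ρ₁ θ θ₀ κ := by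
  obtain ⟨μ₁, μR, h1, hμR, hKat⟩ := hK
  obtain ⟨ν, hν, ε₂, hε₂, h2'⟩ := h2 μ₁ μR h1 hμR hKat
  obtain ⟨ε₁', hε₁', h01'⟩ := h01 hR ν hν
  refine ⟨min ε₁' ε₂, lt_min hε₁' hε₂, fun ε₁ hε₁ hε₁le δ hδ hδ2 => ?_⟩
  obtain ⟨C₁, hC₁, h01''⟩ := h01' ε₁ hε₁ (hε₁le.trans (min_le_left _ _)) δ hδ hδ2
  obtain ⟨C₂, hC₂, h2''⟩ := h2' ε₁ hε₁ (hε₁le.trans (min_le_right _ _)) δ hδ hδ2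
  refine ⟨C₁ + C₂, add_nonneg hC₁ hC₂, fun N y hy => ?_⟩
  obtain ⟨z, hadm, hlow⟩ := h01'' N y hy
  have hsec := h2'' N y hy z hadm
  have hid := pairSum_eq_orders hBT (taylor_of_refAdmissible hδm hy hadm)
  have hF : 0 ≤ (κ - κ₁ - κ₂) * ((farSet θ₀ ρ₁ ε₁ θ δ y).card : ℝ) :=
    mul_nonneg (by linarith) (Nat.cast_nonneg _)
  rw [hid]
  nlinarith [hlow, hsec, hF]

/-- **N_at from the layer-5 pieces (PROVED):** `BT → RD01(κ₁) → N2(κ₂) → δm < 1 → κ₁ + κ₂ ≤ κ → NearClusterFloorAt η R ρ₁ θ θ₀ κ`. [this file] -/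
theorem nearClusterFloorAt_of_orders {η R Rc δm ρ₁ θ θ₀ κ₁ κ₂ κ : ℝ} (hBT : BondTaylorExpansion)
    (h01 : NearReferenceLowOrders η R Rc δm ρ₁ θ θ₀ κ₁) (h2 : NearSecondOrderFloor η R Rc δm ρ₁ θ θ₀ κ₂) (hδm : δm < 1)
    (hκ : κ₁ + κ₂ ≤ κ) : NearClusterFloorAt η R ρ₁ θ θ₀ κ :=
  fun hK hR => nearFloorConclusion_of_orders hBT h01 h2 hK hR hδm hκ

/-- **N_at's conclusion implies RD01 at `κ₁ := κ` (PROVED, trivial reference):** the low-order piece is WEAKER than the target. [this file] -/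
theorem nearReferenceLowOrders_of_conclusion {η R Rc δm ρ₁ θ θ₀ κ : ℝ} (hδm : 0 ≤ δm) (h : NearFloorConclusion ρ₁ θ θ₀ κ) :
    NearReferenceLowOrders η R Rc δm ρ₁ θ θ₀ κ := by
  intro _ ν hν
  obtain ⟨ε₀, hε₀, h'⟩ := h
  refine ⟨ε₀, hε₀, fun ε₁ hε₁ hε₁le δ hδ hδ2 => ?_⟩
  obtain ⟨C, hC, h''⟩ := h' ε₁ hε₁ hε₁le δ hδ hδ2
  refine ⟨C, hC, fun N y hy => ⟨y, refAdmissible_self hδm hy, ?_⟩⟩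
  have h1 := h'' N y hy
  have hF : firstSum (nearSet θ₀ ρ₁ ε₁ θ δ y) (goodSet ρ₁ ε₁ θ δ y) y y = 0 := by
    unfold firstSum; simp
  have hQ : 0 ≤ ν * dispGradSum (101 / 100) (nearSet θ₀ ρ₁ ε₁ θ δ y) (goodSet ρ₁ ε₁ θ δ y) y y :=
    mul_nonneg hν.le (dispGradSum_nonneg _ _ _ _ _)
  rw [hF, add_zero]
  linarith

/-! ## §4  CONES (PROVED compositions) -/

/-- **CONE LIII (slot 3 split to layer 5 along the affine harmonic line; PROVED).**
`0 < η → (∃ μ₁ μR > 0, K_at⁰ η μ₁ μR R) → R_aff → D → BT → RD01(η,R,Rc,δm,ρ₁,θ,θ₀,κ₁) → N2(…,κ₂) → δm < 1 → κ₁ + κ₂ ≤ κ → Z ρ₁ θ θ₀ κ →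
AffMidAll ρ₁ θ → TBDSG`. [this file] -/
theorem tbdsg_of_nearOrders (η R Rc δm ρ₁ θ θ₀ κ₁ κ₂ κ : ℝ) (hη : 0 < η)
    (hK : ∃ μ₁ μR : ℝ, 0 < μ₁ ∧ 0 < μR ∧ PureMarginStabilityAt η μ₁ μR R) (hR : AffineChartStraightening)
    (hD : DefectPairFloor) (hBT : BondTaylorExpansion) (h01 : NearReferenceLowOrders η R Rc δm ρ₁ θ θ₀ κ₁)
    (h2 : NearSecondOrderFloor η R Rc δm ρ₁ θ θ₀ κ₂) (hδm : δm < 1) (hκ : κ₁ + κ₂ ≤ κ) (hZ : FarAggregatePricing ρ₁ θ θ₀ κ)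
    (hM : AffMidAll ρ₁ θ) : TameBalancedDeepScaleGap (122 / 125) 0 4 (3 / 50) (1 / 450) :=
  tbdsg_of_affineLocalisationAt η R ρ₁ θ θ₀ κ hη hK hR hD (nearClusterFloorAt_of_orders hBT h01 h2 hδm hκ) hZ hM

/-- **CONE LIII at the record literals** `η = 3/2000`, `R = 4`, `Rc = 6`, `δm = 1/1000`, `ρ₁ = 12`, `θ = 1/25`, `θ₀ = 1/2000`,
`κ₁ = κ₂ = 1/(2·10⁶)`, `κ = 1/10⁶` (memo §2: at the binding corner a = 1, λ′ = 0, with the CRUDE path-counting Hessian tail a proof of N2 can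
use on bent windows, certifiable `μ₁(η = 3/2000) ≈ 0.572 − 157·η = 0.34 > τ^path(4) = 0.156` (`ν ≈ 0.045`), `η = 1.5·10⁻³ > 2θ₀ = 10⁻³`; at
`R = 3` the path tail 0.34 eats the whole certifiable margin — viable only with a Bloch-sharp tail comparison; K-side cost of `R = 4`: I-SOS target `H₄`
(380 bonds) at stencil radius `2a`, SDP dimension 162 = already run). [this file] -/
theorem tbdsg_of_nearOrders_record
    (hK : ∃ μ₁ μR : ℝ, 0 < μ₁ ∧ 0 < μR ∧ PureMarginStabilityAt (3 / 2000) μ₁ μR 4) (hR : AffineChartStraightening)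
    (hD : DefectPairFloor) (hBT : BondTaylorExpansion)
    (h01 : NearReferenceLowOrders (3 / 2000) 4 6 (1 / 1000) 12 (1 / 25) (1 / 2000) (1 / (2 * 10 ^ 6)))
    (h2 : NearSecondOrderFloor (3 / 2000) 4 6 (1 / 1000) 12 (1 / 25) (1 / 2000) (1 / (2 * 10 ^ 6)))
    (hZ : FarAggregatePricing 12 (1 / 25) (1 / 2000) (1 / 10 ^ 6)) (hM : AffMidAll 12 (1 / 25)) :
    TameBalancedDeepScaleGap (122 / 125) 0 4 (3 / 50) (1 / 450) :=
  tbdsg_of_nearOrders (3 / 2000) 4 6 (1 / 1000) 12 (1 / 25) (1 / 2000) (1 / (2 * 10 ^ 6)) (1 / (2 * 10 ^ 6)) (1 / 10 ^ 6)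
    (by norm_num) hK hR hD hBT h01 h2 (by norm_num) (by norm_num) hZ hM

/-- **RDEF CONE LIII (thirteen slots)** — cone XLVI with slot 3 replaced by the layer-5 affine harmonic line. [this file] -/
theorem rdef_of_ceg_shape_nearOrders (η R Rc δm ρ₁ θ θ₀ κ₁ κ₂ κ : ℝ) (hη : 0 < η) (hCEG : ChargedEnergyGap)
    (hT : TwoShellShape (1 / 100) (3 / 50) (1 / 450))
    (hK : ∃ μ₁ μR : ℝ, 0 < μ₁ ∧ 0 < μR ∧ PureMarginStabilityAt η μ₁ μR R) (hR : AffineChartStraightening)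
    (hD : DefectPairFloor) (hBT : BondTaylorExpansion) (h01 : NearReferenceLowOrders η R Rc δm ρ₁ θ θ₀ κ₁)
    (h2 : NearSecondOrderFloor η R Rc δm ρ₁ θ θ₀ κ₂) (hδm : δm < 1) (hκ : κ₁ + κ₂ ≤ κ) (hZ : FarAggregatePricing ρ₁ θ θ₀ κ)
    (hM : AffMidAll ρ₁ θ) (hCE : CleanlessExcessT) (hRes : CoherentResidual 10) : RobustDefectLimitWindows :=
  rdef_of_ceg_shape_balancedDeep_record hCEG hT
    (tbdsg_of_nearOrders η R Rc δm ρ₁ θ θ₀ κ₁ κ₂ κ hη hK hR hD hBT h01 h2 hδm hκ hZ hM) hCE hRes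

end Summit.AtomisticToContinuum.Crystallization.Theorems.OverbindingBudgetAffineNearCluster
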